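import Literature.Barriers.CriticalPhenomena.PlaquetteWalkAngleLimitCoefficient
import Mathlib.RingTheory.Polynomial.Cyclotomic.Roots
import Mathlib.RingTheory.RootsOfUnity.Complex
import HarnessLib

/-!
# Barrier catalogue (SAWScalingLimit): the limit weights of the printed Yang–Baxter family live in `ℤ[ζ₃₂]`, and an
element of `ℚ(ζ₃₂)` vanishes iff its sixteen coordinates vanish («LIMIT WEIGHTS IN ℤ[ζ₃₂]»)

Companion of `PlaquetteWalkAngleLimitCoefficient` (the `Z → ∞` limit model: `limitWeight`, `limitCoeff`). The exact census of
the lane (FINDING-YB-LIMIT-MODEL) evaluates the limit coefficients in `ℤ[ζ]`, `ζ = e^{iπ/16}` a primitive 32nd root of unity,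
and decides «`Λ ≠ 0`» by reading integer coordinates. This file makes that exact:

* `zeta32 = e^{iπ/16}` is a primitive 32nd root of unity (`isPrimitiveRoot_zeta32`), `ζ¹⁶ = −1`, `ζ³² = 1`;
* ★★ `eq_zero_of_sum_zeta32_pow_eq_zero` — **a rational combination `Σ_{k<16} c_k ζ^k` vanishes only if every `c_k = 0`**
  (the minimal polynomial of `ζ` over `ℚ` is the cyclotomic polynomial `Φ₃₂`, of degree `φ(32) = 16`);
* the constants of the limit model as elements of `ℤ[ζ]`: `slotUnit = ζ⁵`, `tFiveEighths = ζ²⁷`, `−2i·sin(5π/4) = ζ⁴ + ζ¹²`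
  (`= i√2`), `e^{−5iπ/8} = −ζ⁶`, `e^{−5iπ/4} = ζ¹²`, `e^{5iπ/4} = −ζ⁴`, `lead(Z²·Den) = ζ¹⁰/4`
  (`slotUnit_eq`, `tFiveEighths_eq_zeta32_pow`, `neg_two_I_sin_eq`, `exp_neg_five_pi_eighth_eq`, `exp_neg_five_pi_fourth_eq`,
  `exp_five_pi_fourth_eq`, `leadingCoeff_ybDenPoly_eq`);
* ★ `limitWeight_eq_zeta32` — the limit weight of a mid-edge list is `±ζ^{5·[s∈{N,S}]} · ζ^{27q} · (ζ⁴+ζ¹²)^{n₁+n₂} · (−ζ⁶)^{n₂} ·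
  (ζ¹²)^{n_{w₁}} · (−ζ⁴)^{n_{w₂}}`, an element of `ℤ[ζ]` given by the walk's exponent vector and quarter-turn count.

Use: with the wound form (`PlaquetteWalkAngleLimitCoefficientWound`) a kernel certificate of «VF ≢ 0» at a cell reduces to
integer bookkeeping in the sixteen coordinates of `Σ limitWeight` (the census scripts `ztop.py`/`zcensus.py` print exactly these).
Elementary algebra (cyclotomic minimal polynomial; Euler's formula).
-/

noncomputable section

namespace Literature.Barriers.CriticalPhenomena.PlaquetteWalk

open Literature.Probability.RandomPlanarGeometry.SAW.YangBaxter
open Real Complex Polynomial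

/-! ## `ζ = e^{iπ/16}` -/

section Zeta

/-- `ζ₃₂ = e^{iπ/16}`, the primitive 32nd root of unity of the lane's exact census. [cite: GlazmanManolescu2019, §1, eq. (1) (the weights at the dyadic angles; lane plumbing)] -/
def zeta32 : ℂ := Complex.exp (((π / 16 : ℝ) : ℂ) * I)

/-- `ζ = e^{2πi/32}`. [cite: GlazmanManolescu2019, §1, eq. (1) (lane plumbing)] -/
theorem zeta32_eq_exp : zeta32 = Complex.exp (2 * π * I / (32 : ℕ)) := by
  rw [zeta32]; congr 1; push_cast; ring

/-- `ζ` is a primitive 32nd root of unity. [cite: GlazmanManolescu2019, §1, eq. (1) (lane plumbing)] -/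
theorem isPrimitiveRoot_zeta32 : IsPrimitiveRoot zeta32 32 := by
  rw [zeta32_eq_exp]; exact Complex.isPrimitiveRoot_exp 32 (by norm_num)

/-- `ζ ≠ 0`. [cite: GlazmanManolescu2019, §1, eq. (1) (lane plumbing)] -/
theorem zeta32_ne_zero : zeta32 ≠ 0 := Complex.exp_ne_zero _

/-- `ζ^n = e^{iπn/16}`. [cite: GlazmanManolescu2019, §1, eq. (1) (lane plumbing)] -/
theorem zeta32_pow (n : ℕ) : zeta32 ^ n = Complex.exp (((n * π / 16 : ℝ) : ℂ) * I) := by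
  rw [zeta32, ← Complex.exp_nat_mul]; congr 1; push_cast; ring

/-- `ζ¹⁶ = −1`. [cite: GlazmanManolescu2019, §1, eq. (1) (lane plumbing)] -/
theorem zeta32_pow_sixteen : zeta32 ^ 16 = -1 := by
  rw [zeta32_pow]
  have : (((16 : ℕ) * π / 16 : ℝ) : ℂ) * I = π * I := by push_cast; ring
  rw [this, Complex.exp_pi_mul_I]

/-- `ζ³² = 1`. [cite: GlazmanManolescu2019, §1, eq. (1) (lane plumbing)] -/
theorem zeta32_pow_thirtyTwo : zeta32 ^ 32 = 1 := isPrimitiveRoot_zeta32.pow_eq_one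

/-- The minimal polynomial of `ζ` over `ℚ` has degree `16`. [folklore] -/
private theorem natDegree_minpoly_zeta32 : (minpoly ℚ zeta32).natDegree = 16 := by
  rw [← Polynomial.cyclotomic_eq_minpoly_rat isPrimitiveRoot_zeta32 (by norm_num), Polynomial.natDegree_cyclotomic]
  decide

/-- ★★ **SIXTEEN COORDINATES**: a rational combination of `1, ζ, …, ζ¹⁵` vanishes only if all its coefficients vanish (`Φ₃₂` is the
minimal polynomial of `ζ`, of degree `16`). [cite: GlazmanManolescu2019, §1, eq. (1) (standard cyclotomic algebra; lane plumbing for the exact census)] -/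
theorem eq_zero_of_sum_zeta32_pow_eq_zero (c : Fin 16 → ℚ) (h : ∑ i : Fin 16, (c i : ℂ) * zeta32 ^ (i : ℕ) = 0) :
    ∀ i, c i = 0 := by
  -- the polynomial `Σ c_i X^i` has `ζ` as a root and degree `< 16`, so it is divisible by the minimal polynomial, hence zero
  set p : ℚ[X] := ∑ i : Fin 16, C (c i) * X ^ (i : ℕ) with hp
  have hroot : Polynomial.aeval zeta32 p = 0 := by
    rw [hp, map_sum]
    simp only [map_mul, Polynomial.aeval_C, map_pow, Polynomial.aeval_X]
    convert h using 2 with i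
    simp
  have hdvd := minpoly.dvd ℚ zeta32 hroot
  have hdeg : p.natDegree < 16 := by
    have h15 : p.natDegree ≤ 15 :=
      natDegree_sum_le_of_forall_le _ _ fun i _ => (natDegree_C_mul_X_pow_le (c i) (i : ℕ)).trans (by have := i.isLt; omega)
    omega
  have hp0 : p = 0 := by
    by_contra hne
    have := Polynomial.eq_zero_of_dvd_of_natDegree_lt hdvd (by rw [natDegree_minpoly_zeta32]; exact hdeg)
    exact hne this
  intro i
  have hc := congrArg (fun q : ℚ[X] => q.coeff (i : ℕ)) hp0
  simp only [hp, finsetSum_coeff, coeff_C_mul, coeff_X_pow, coeff_zero] at hc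
  rw [Finset.sum_eq_single i] at hc
  · simpa using hc
  · intro j _ hji
    have : (i : ℕ) ≠ (j : ℕ) := fun e => hji (Fin.ext e).symm
    simp [this]
  · intro hi; exact absurd (Finset.mem_univ i) hi

/-- The same with integer coefficients (the coordinates used by the lane's exact census). [cite: GlazmanManolescu2019, §1, eq. (1) (standard cyclotomic algebra; lane plumbing)] -/
theorem eq_zero_of_sum_zeta32_pow_eq_zero_int (c : Fin 16 → ℤ) (h : ∑ i : Fin 16, (c i : ℂ) * zeta32 ^ (i : ℕ) = 0) :
    ∀ i, c i = 0 := by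
  have h' : ∑ i : Fin 16, (((c i : ℚ) : ℂ)) * zeta32 ^ (i : ℕ) = 0 := by
    convert h using 2 with i; push_cast; rfl
  intro i
  have := eq_zero_of_sum_zeta32_pow_eq_zero (fun i => (c i : ℚ)) h' i
  exact_mod_cast this

end Zeta

/-! ## The constants of the limit model in `ℤ[ζ]` -/

section Constants

/-- `e^{iπk/16} = ζ^k` for natural `k` (restatement). [cite: GlazmanManolescu2019, §1, eq. (1) (lane plumbing)] -/
private theorem exp_eq_zeta32_pow (k : ℕ) (x : ℝ) (hx : x = k * π / 16) : Complex.exp ((x : ℂ) * I) = zeta32 ^ k := by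
  rw [zeta32_pow, hx]

/-- `slotUnit = e^{5iπ/16} = ζ⁵`. [cite: GlazmanManolescu2019, Lemma 2.1, eq. (CR)] -/
theorem slotUnit_eq : slotUnit = zeta32 ^ 5 := by
  rw [slotUnit]; exact exp_eq_zeta32_pow 5 _ (by push_cast; ring)

/-- `t = e^{−5iπ/16} = ζ²⁷`. [cite: GlazmanManolescu2019, §2.1, eq. (2.1)] -/
theorem tFiveEighths_eq_zeta32_pow : tFiveEighths = zeta32 ^ 27 := by
  have h27 : zeta32 ^ 27 = zeta32 ^ 32 * (zeta32 ^ 5)⁻¹ := by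
    rw [eq_mul_inv_iff_mul_eq₀ (pow_ne_zero _ zeta32_ne_zero), ← pow_add]
  rw [h27, zeta32_pow_thirtyTwo, one_mul, ← slotUnit_eq, slotUnit, tFiveEighths, ← Complex.exp_neg]
  congr 1; push_cast; ring

/-- `e^{5iπ/4} = ζ²⁰ = −ζ⁴`. [cite: GlazmanManolescu2019, §1, eq. (1)] -/
theorem exp_five_pi_fourth_eq : Complex.exp (((5 * π / 4 : ℝ) : ℂ) * I) = -zeta32 ^ 4 := by
  rw [exp_eq_zeta32_pow 20 _ (by ring), show (20 : ℕ) = 16 + 4 by norm_num, pow_add, zeta32_pow_sixteen]; ring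

/-- `e^{−5iπ/4} = ζ¹²`. [cite: GlazmanManolescu2019, §1, eq. (1)] -/
theorem exp_neg_five_pi_fourth_eq : Complex.exp (-(((5 * π / 4 : ℝ) : ℂ) * I)) = zeta32 ^ 12 := by
  have h : zeta32 ^ 12 * Complex.exp (((5 * π / 4 : ℝ) : ℂ) * I) = 1 := by
    rw [exp_five_pi_fourth_eq, mul_neg, ← pow_add, show (12 + 4 : ℕ) = 16 by norm_num, zeta32_pow_sixteen]; ring
  rw [Complex.exp_neg]
  exact (eq_inv_of_mul_eq_one_left h).symm

/-- `e^{−5iπ/8} = −ζ⁶` (`= ζ²²`). [cite: GlazmanManolescu2019, §1, eq. (1)] -/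
theorem exp_neg_five_pi_eighth_eq : Complex.exp (-(((5 * π / 8 : ℝ) : ℂ) * I)) = -zeta32 ^ 6 := by
  have h10 : Complex.exp (((5 * π / 8 : ℝ) : ℂ) * I) = zeta32 ^ 10 := exp_eq_zeta32_pow 10 _ (by ring)
  have h : -zeta32 ^ 6 * Complex.exp (((5 * π / 8 : ℝ) : ℂ) * I) = 1 := by
    rw [h10, neg_mul, ← pow_add, show (6 + 10 : ℕ) = 16 by norm_num, zeta32_pow_sixteen]; ring
  rw [Complex.exp_neg]
  exact (eq_inv_of_mul_eq_one_left h).symm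

/-- `−2i·sin(5π/4) = ζ⁴ + ζ¹²` (`= i√2`). [cite: GlazmanManolescu2019, §1, eq. (1)] -/
theorem neg_two_I_sin_eq : (-2 * I * ((Real.sin (5 * π / 4) : ℝ) : ℂ)) = zeta32 ^ 4 + zeta32 ^ 12 := by
  rw [Complex.ofReal_sin]
  have h2 := Complex.two_sin (((5 * π / 4 : ℝ) : ℂ))
  have e1 : Complex.exp (((5 * π / 4 : ℝ) : ℂ) * I) = -zeta32 ^ 4 := exp_five_pi_fourth_eq
  have e2 : Complex.exp (-((5 * π / 4 : ℝ) : ℂ) * I) = zeta32 ^ 12 := by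
    rw [neg_mul]; exact exp_neg_five_pi_fourth_eq
  rw [e1, e2] at h2
  have hI : I * I = -1 := Complex.I_mul_I
  linear_combination (-I) * h2 + (-(zeta32 ^ 12 + zeta32 ^ 4)) * hI

/-- `lead(Z²·Den) = ζ¹⁰/4`. [cite: GlazmanManolescu2019, §1, eq. (1)] -/
theorem leadingCoeff_ybDenPoly_eq : ybDenPoly.leadingCoeff = zeta32 ^ 10 / 4 := by
  rw [leadingCoeff_ybDenPoly, leadingCoeff_sinPolyP, leadingCoeff_sinPolyM]
  have e : Complex.exp (((5 * π / 4 : ℝ) : ℂ) * I) * Complex.exp (-(((5 * π / 8 : ℝ) : ℂ) * I)) = zeta32 ^ 10 := by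
    rw [← Complex.exp_add, ← exp_eq_zeta32_pow 10 (5 * π / 4 - 5 * π / 8) (by ring)]
    congr 1; push_cast; ring
  have hI : I * I = -1 := Complex.I_mul_I
  linear_combination (-(I * I) / 4) * e + (-(zeta32 ^ 10) / 4) * hI

end Constants

/-! ## The limit weight in `ℤ[ζ]` -/

section LimitWeightZeta

/-- The slot sign `(1, 1, −1, −1)` and slot exponent `(0, 5, 0, 5)`: `slotLead s = slotSign s · ζ^{slotExp s}`.
[cite: GlazmanManolescu2019, Lemma 2.1, eq. (CR)] -/
def slotSign (s : Fin 4) : ℂ := ![1, 1, -1, -1] s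

/-- The slot exponent. [cite: GlazmanManolescu2019, Lemma 2.1, eq. (CR)] -/
def slotExp (s : Fin 4) : ℕ := ![0, 5, 0, 5] s

/-- `slotLead s = slotSign s · ζ^{slotExp s}`. [cite: GlazmanManolescu2019, Lemma 2.1, eq. (CR)] -/
theorem slotLead_eq (s : Fin 4) : slotLead s = slotSign s * zeta32 ^ slotExp s := by
  fin_cases s <;> simp [slotLead, slotSign, slotExp, slotUnit_eq]

/-- ★ **THE LIMIT WEIGHT IN `ℤ[ζ]`**: for every slot and mid-edge list,
`limitWeight_s(l) = slotSign s · ζ^{slotExp s} · (ζ²⁷)^{q} · (ζ⁴ + ζ¹²)^{n₁} · ((ζ⁴ + ζ¹²)·(−ζ⁶))^{n₂} · (ζ¹²)^{n_{w₁}} · (−ζ⁴)^{n_{w₂}}`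
(`q` the signed quarter-turn count, an integer power). [cite: GlazmanManolescu2019, §1, eq. (1); Lemma 2.1, eq. (CR)] -/
theorem limitWeight_eq_zeta32 (s : Fin 4) (l : List MidEdge) :
    limitWeight s l = slotSign s * zeta32 ^ slotExp s * (zeta32 ^ 27) ^ quarterTurnsL l *
      ((zeta32 ^ 4 + zeta32 ^ 12) ^ cfgCount l [.corner] *
        ((zeta32 ^ 4 + zeta32 ^ 12) * -zeta32 ^ 6) ^ cfgCount l [.coCorner] *
        (zeta32 ^ 12) ^ cfgCount l [.corner, .corner] * (-zeta32 ^ 4) ^ cfgCount l [.coCorner, .coCorner]) := by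
  rw [limitWeight, slotLead_eq, tFiveEighths_eq_zeta32_pow, neg_two_I_sin_eq, exp_neg_five_pi_eighth_eq,
    exp_neg_five_pi_fourth_eq, exp_five_pi_fourth_eq]

end LimitWeightZeta

end Literature.Barriers.CriticalPhenomena.PlaquetteWalk
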